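import Literature.NumberTheory.Automorphic.CDTThreeFiveSwitchHolds
import HarnessLib

/-!
# Crux `FreyModularity` (stmt-ABC-11340), line `Sketch`: the registered stub `stub_switch`, CLOSED

`stub_switch` (Wiles' `3`–`5` switch from a curve; CDT 1999, proof of Thm. 7.1.2, p. 556) is
registered with the signature of the named fact `BCDT.CDT_three_five_switch` unfolded
(`Sketch.stub_switch_iff_CDT_three_five_switch` is `Iff.rfl`), and that fact is a theorem of
`Literature` (`BCDT.CDT_three_five_switch_holds`, `CDTThreeFiveSwitchHolds`).  Registered signature
VERBATIM below.
-/

-- `Summit.<Summit>.<Problem>` is the mandated summit-side namespace (CONVENTIONS §2); for the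
-- single-conjunct summit `ABC` the two coincide, so the duplicate `ABC.ABC` is deliberate.
set_option linter.dupNamespace false

open _root_.Literature.NumberTheory.GaloisRepresentations
open _root_.Literature.NumberTheory.Automorphic _root_.Literature.NumberTheory.Automorphic.BCDT _root_.WeierstrassCurve

namespace Summit.ABC.ABC.Theorems

/-- **The registered stub `stub_switch` of crux `FreyModularity` (stmt-ABC-11340), signature verbatim.**
[cite: ConradDiamondTaylor1999, proof of Thm. 7.1.2 (p. 556)] -/
theorem stub_switch :
    ∀ (W : WeierstrassCurve ℚ) [W.IsElliptic], ¬ 27 ∣ W.conductorNorm ℤ →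
      (∀ ρ₃ : ModPGaloisRep ℚ (ZMod 3) 2, W.IsTorsionGaloisRep 3 ρ₃ →
        ¬ ρ₃.IsAbsIrreducibleOverSqrt (-3)) →
      ∀ (ρ : ModPGaloisRep ℚ (ZMod 5) 2), W.IsTorsionGaloisRep 5 ρ → ρ.IsAbsIrreducibleOverSqrt 5 →
      ∃ (W' : WeierstrassCurve ℚ) (_ : W'.IsElliptic), W'.IsTorsionGaloisRep 5 ρ ∧
        ∃ ρ₃' : ModPGaloisRep ℚ (ZMod 3) 2, W'.IsTorsionGaloisRep 3 ρ₃' ∧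
          ρ₃'.IsAbsIrreducibleOverSqrt (-3) :=
  CDT_three_five_switch_holds

end Summit.ABC.ABC.Theorems
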